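import Mathlib
import Literature.NumberTheory.Sieve.PolymathGEHDivisorShort

/-!
# Divisor sums on a short interval in one coprime residue class

Crux stmt-Parity-13325 `LiouvilleMAD.LambdaLiouvilleLevel`, line `log-power-dispersion`,
stub `stub_classDivisorShortSum` (the unfolded `ClassDivisorShortSum` of the line's skeleton):
for `q ≥ 1`, `(w, q) = 1` and `Z₁ ≤ Z₂`,
`Σ_{Z₁ < n ≤ Z₂, n ≡ w (q)} τ(n) ≤ 2((Z₂ − Z₁)/q + 1)(1 + log Z₂) + 2√Z₂`.

Proof (hyperbola method in ONE coprime class):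
* pointwise, `τ(n) ≤ 2 · #{a ∣ n : a² ≤ n} ≤ 2 · #{a ∈ [1, s] : a ∣ n}` with `s = ⌊√Z₂⌋`
  (`Literature.NumberTheory.Sieve.sigma_zero_le_two_mul_card_small_divisors`);
* swap the two sums; for a fixed `a ≤ s` the integers `n` counted are `≡ w (q)` and `≡ 0 (a)`,
  and `(a, q) = 1` is forced (`a ∣ n`, `gcd(n, q) = gcd(w, q) = 1`), so by CRT they lie in ONE
  class modulo `aq` inside `(Z₁, Z₂]`: at most `(Z₂ − Z₁ − 1)/(aq) + 1` of them
  (the map `n ↦ (n − Z₁ − 1)/(aq)` is injective into `range ((Z₂ − Z₁ − 1)/(aq) + 1)`);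
* sum over `a ≤ s`: `Σ_{a ≤ s} 1/a ≤ 1 + log s ≤ 1 + log Z₂` (`harmonic_le_one_add_log`) and
  `s ≤ √Z₂`.
-/

noncomputable section

namespace Summit.Parity.GeneralizedHardyLittlewood.Theorems.LambdaLiouvilleLevel.LogPowerDispersion

open Finset Real

/-- A finite set of naturals inside `(Z₁, Z₂]` whose elements are pairwise congruent modulo
`r ≥ 1` has at most `(Z₂ - Z₁ - 1) / r + 1` elements: `n ↦ (n - Z₁ - 1) / r` is injective on it
with values `≤ (Z₂ - Z₁ - 1) / r`. [folklore] -/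
theorem card_le_of_pairwise_modEq {r Z₁ Z₂ : ℕ} (hr : 0 < r) (T : Finset ℕ)
    (hT : T ⊆ Finset.Ioc Z₁ Z₂) (hmod : ∀ n ∈ T, ∀ n' ∈ T, n ≡ n' [MOD r]) :
    T.card ≤ (Z₂ - Z₁ - 1) / r + 1 := by
  calc T.card ≤ (Finset.range ((Z₂ - Z₁ - 1) / r + 1)).card := by
        refine Finset.card_le_card_of_injOn (fun n => (n - (Z₁ + 1)) / r) ?_ ?_
        · intro n hn
          rw [Finset.mem_coe] at hn
          have h := Finset.mem_Ioc.1 (hT hn)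
          rw [Finset.mem_coe, Finset.mem_range, Nat.lt_add_one_iff]
          exact Nat.div_le_div_right (by omega)
        · intro n hn n' hn' heq
          rw [Finset.mem_coe] at hn hn'
          by_contra hne
          wlog hlt : n < n' generalizing n n'
          · exact this hn' hn heq.symm (Ne.symm hne) (lt_of_le_of_ne (not_lt.1 hlt) (Ne.symm hne))
          have h1 := Finset.mem_Ioc.1 (hT hn)
          obtain ⟨t, ht⟩ := (Nat.modEq_iff_dvd' hlt.le).1 (hmod n hn n' hn')
          have ht0 : 0 < t := by
            rcases Nat.eq_zero_or_pos t with h0 | h0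
            · rw [h0, mul_zero] at ht; omega
            · exact h0
          have hrt : r ≤ r * t := Nat.le_mul_of_pos_right r ht0
          have e : n' - (Z₁ + 1) = n - (Z₁ + 1) + r * t := by omega
          simp only at heq
          rw [e, Nat.add_mul_div_left _ _ hr] at heq
          omega
    _ = (Z₂ - Z₁ - 1) / r + 1 := Finset.card_range _

/-- **Divisor sums on a short interval in ONE coprime class (hyperbola method).**  For `q ≥ 1`,
`(w, q) = 1` and `Z₁ ≤ Z₂`:
`Σ_{Z₁ < n ≤ Z₂, n ≡ w (q)} τ(n) ≤ 2((Z₂ − Z₁)/q + 1)(1 + log Z₂) + 2√Z₂`.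
This is the unfolded `ClassDivisorShortSum` of the line `log-power-dispersion`
(crux stmt-Parity-13325). [folklore; cite: IwaniecKowalski2004 §1.5 (hyperbola method)] -/
theorem classDivisorShortSum :
    ∀ q w Z₁ Z₂ : ℕ, 1 ≤ q → Nat.Coprime w q → Z₁ ≤ Z₂ →
      (∑ n ∈ (Finset.Ioc Z₁ Z₂).filter (fun n : ℕ => n ≡ w [MOD q]), ((Nat.divisors n).card : ℝ)) ≤
        2 * ((((Z₂ - Z₁ : ℕ) : ℝ)) / q + 1) * (1 + Real.log Z₂) + 2 * Real.sqrt Z₂ := by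
  intro q w Z₁ Z₂ hq hw hZ
  set S := (Finset.Ioc Z₁ Z₂).filter (fun n : ℕ => n ≡ w [MOD q]) with hS
  set s := Nat.sqrt Z₂ with hs
  -- Step 1: `τ(n) ≤ 2 #{d ≤ s : d ∣ n}` for `n ∈ S`
  have step1 : ∀ n ∈ S, ((Nat.divisors n).card : ℝ) ≤ 2 * #((Icc 1 s).filter fun d => d ∣ n) := by
    intro n hn
    have hn' := Finset.mem_Ioc.1 (Finset.mem_filter.1 hn).1
    have h1 := Literature.NumberTheory.Sieve.sigma_zero_le_two_mul_card_small_divisors n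
    rw [ArithmeticFunction.sigma_zero_apply] at h1
    have h2 : #(n.divisors.filter fun d => d * d ≤ n) ≤ #((Icc 1 s).filter fun d => d ∣ n) := by
      refine Finset.card_le_card fun d hd => ?_
      rw [Finset.mem_filter, Nat.mem_divisors] at hd
      rw [Finset.mem_filter, Finset.mem_Icc]
      refine ⟨⟨Nat.pos_of_dvd_of_pos hd.1.1 (by omega), ?_⟩, hd.1.1⟩
      rw [hs, Nat.le_sqrt]
      exact hd.2.trans hn'.2
    exact_mod_cast h1.trans (Nat.mul_le_mul_left 2 h2)
  -- Step 2: swap the sums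
  have step2 : ∑ n ∈ S, (#((Icc 1 s).filter fun d => d ∣ n) : ℝ) =
      ∑ d ∈ Icc 1 s, (#(S.filter fun n => d ∣ n) : ℝ) := by
    simp only [Finset.card_eq_sum_ones, Nat.cast_sum, Finset.sum_filter]
    push_cast
    exact Finset.sum_comm
  -- Step 3: for each `d`, the `n ∈ S` with `d ∣ n` lie in one class modulo `d * q`
  have step3 : ∀ d ∈ Icc 1 s, (#(S.filter fun n => d ∣ n) : ℝ) ≤
      ((Z₂ - Z₁ : ℕ) : ℝ) / q * (1 / d) + 1 := by
    intro d hd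
    rw [Finset.mem_Icc] at hd
    have hdq : 0 < d * q := Nat.mul_pos hd.1 hq
    have hnat : #(S.filter fun n => d ∣ n) ≤ (Z₂ - Z₁) / (d * q) + 1 := by
      refine (card_le_of_pairwise_modEq (Z₁ := Z₁) (Z₂ := Z₂) hdq _ ?_ ?_).trans ?_
      · intro n hn
        exact (Finset.mem_filter.1 (Finset.mem_filter.1 hn).1).1
      · intro n hn n' hn'
        rw [Finset.mem_filter, hS, Finset.mem_filter] at hn hn'
        have hcop : Nat.Coprime d q := by
          have hnq : Nat.Coprime n q := hn.1.2.gcd_eq.trans hw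
          exact hnq.coprime_dvd_left hn.2
        refine (Nat.modEq_and_modEq_iff_modEq_mul hcop).1 ⟨?_, hn.1.2.trans hn'.1.2.symm⟩
        exact (Nat.modEq_zero_iff_dvd.2 hn.2).trans (Nat.modEq_zero_iff_dvd.2 hn'.2).symm
      · exact Nat.add_le_add_right (Nat.div_le_div_right (Nat.sub_le _ _)) 1
    have hcast : ((#(S.filter fun n => d ∣ n) : ℕ) : ℝ) ≤ (((Z₂ - Z₁) / (d * q) : ℕ) : ℝ) + 1 := by
      exact_mod_cast hnat
    refine hcast.trans ?_
    have h1 : (((Z₂ - Z₁) / (d * q) : ℕ) : ℝ) ≤ ((Z₂ - Z₁ : ℕ) : ℝ) / ((d * q : ℕ) : ℝ) :=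
      Nat.cast_div_le
    have h2 : ((Z₂ - Z₁ : ℕ) : ℝ) / ((d * q : ℕ) : ℝ) = ((Z₂ - Z₁ : ℕ) : ℝ) / q * (1 / d) := by
      rw [Nat.cast_mul]
      ring
    linarith
  -- Step 4: harmonic sum and `s ≤ √Z₂`
  have hlog : 0 ≤ 1 + Real.log Z₂ := by linarith [Real.log_natCast_nonneg Z₂]
  have hH : ∑ d ∈ Icc 1 s, (1 : ℝ) / d ≤ 1 + Real.log Z₂ := by
    rcases Nat.eq_zero_or_pos s with h0 | hs0
    · rw [h0, Finset.Icc_eq_empty_of_lt Nat.one_pos, Finset.sum_empty]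
      exact hlog
    · have h1 : ∑ d ∈ Icc 1 s, (1 : ℝ) / d = harmonic s := by
        rw [harmonic_eq_sum_Icc]
        push_cast
        refine Finset.sum_congr rfl fun d _ => ?_
        rw [one_div]
      rw [h1]
      refine (harmonic_le_one_add_log s).trans ?_
      have : Real.log s ≤ Real.log Z₂ := by
        refine Real.log_le_log (by exact_mod_cast hs0) ?_
        exact_mod_cast Nat.sqrt_le_self Z₂
      linarith
  have hsq : (s : ℝ) ≤ Real.sqrt Z₂ := by
    rw [hs]
    exact Real.nat_sqrt_le_real_sqrt
  have hD : 0 ≤ ((Z₂ - Z₁ : ℕ) : ℝ) / q := by positivity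
  have hDH := mul_le_mul_of_nonneg_left hH hD
  calc ∑ n ∈ S, ((Nat.divisors n).card : ℝ)
      ≤ ∑ n ∈ S, (2 * #((Icc 1 s).filter fun d => d ∣ n) : ℝ) := Finset.sum_le_sum step1
    _ = 2 * ∑ d ∈ Icc 1 s, (#(S.filter fun n => d ∣ n) : ℝ) := by rw [← Finset.mul_sum, step2]
    _ ≤ 2 * ∑ d ∈ Icc 1 s, (((Z₂ - Z₁ : ℕ) : ℝ) / q * (1 / d) + 1) :=
        mul_le_mul_of_nonneg_left (Finset.sum_le_sum step3) (by norm_num)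
    _ = 2 * (((Z₂ - Z₁ : ℕ) : ℝ) / q * ∑ d ∈ Icc 1 s, (1 : ℝ) / d) + 2 * s := by
        rw [Finset.sum_add_distrib, Finset.sum_const, Nat.card_Icc, nsmul_eq_mul, ← Finset.mul_sum,
          add_tsub_cancel_right, mul_one]
        ring
    _ ≤ 2 * (((Z₂ - Z₁ : ℕ) : ℝ) / q * (1 + Real.log Z₂)) + 2 * Real.sqrt Z₂ := by linarith
    _ ≤ 2 * ((((Z₂ - Z₁ : ℕ) : ℝ)) / q + 1) * (1 + Real.log Z₂) + 2 * Real.sqrt Z₂ := by nlinarith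

end Summit.Parity.GeneralizedHardyLittlewood.Theorems.LambdaLiouvilleLevel.LogPowerDispersion

end
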